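import Summits.CriticalPhenomena.Ising3DConformalLimit.Theorems.HyperoctahedralRPExistsScaleCovariantLimitBlockDefs
import Summits.CriticalPhenomena.Ising3DConformalLimit.Theorems.EnergyNotSigmaSquaredMoebiusLimitExistsLocallyBounded
import Literature.Probability.LatticeModels.CriticalBlockMoments
import HarnessLib

/-!
# Uniform bounds for the normalised block moments of the critical `ℤ³` Ising model
(line `monotone-blocking-port` of crux `ExistsScaleCovariantLimit`, stmt-CriticalPhenomena-1981;
stub `stub_blockMomentBounded`, S3)

For the ONE critical nearest-neighbour Ising measure on `ℤ³`, the normalised block moments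
`R_n(L; k⃗) = Σ_{xᵢ ∈ cube L} ⟨∏ᵢ σ_{xᵢ + L kᵢ}⟩_{β_c} / V(L)^{n/2}` (`critBlockMoment`, with
`V(L) = C(L;0) = Σ_{x,y ∈ cube L} ⟨σ_xσ_y⟩_{β_c}` the block variance, `blockCov L 0`) are bounded
uniformly in the block side `L ≥ 1`: `|R_n(L; k⃗)| ≤ C(n)` (coincidences in `k⃗` allowed).

Proof.
* Odd `n`: the critical odd correlators vanish (`criticalCorr_eq_zero_of_odd`), so `R_n = 0`.
* `n = 0`: the numerator is the empty correlator, of modulus `≤ 1`, and `V^0 = 1`.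
* `n = 2m ≥ 2`: the numerator is `N = E[∏ᵢ B(kᵢ)]` with the block variables
  `B(k) = Σ_{x ∈ cube L} σ_{x + Lk}`, the expectation being the integral against a plus Gibbs
  measure at `β_c` (`exists_isProbabilityMeasure_spinCorr_eq_plusCorr`,
  `criticalCorr_eq_integral_spinMonomial`). It is `≥ 0` termwise (Griffiths I, the tree's
  `criticalCorr_nonneg'`). Pointwise AM–GM (`Real.geom_mean_le_arith_mean_weighted`) gives
  `∏ᵢ B(kᵢ) ≤ (1/n) Σᵢ B(kᵢ)ⁿ`, and `E[B(k)^{2m}] = Σ_{x⃗ ∈ (cube L)^{2m}} ⟨∏ σ_{xⱼ + Lk}⟩_{β_c}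
  = Σ_{x⃗} ⟨∏ σ_{xⱼ}⟩_{β_c}` (translation invariance, `criticalCorr_translate`), which by NEWMAN'S
  GAUSSIAN INEQUALITY for the critical state (`criticalCorr_le_pairingSum`) and the smeared Wick law
  (`sum_prod_mul_pairingSum` with unit weights) is at most `(2m)!/(2ᵐ m!) · V(L)ᵐ`. Hence
  `0 ≤ N ≤ (2m−1)!! V(L)ᵐ`, and `V(L)^{(2m)/2} = V(L)ᵐ > 0` for `L ≥ 1` (`⟨σ₀σ₀⟩ = 1`, all terms
  `≥ 0`), so `|R_{2m}(L; k⃗)| ≤ (2m)!/(2ᵐ m!)`.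

References: C. M. Newman, Z. Wahrsch. 33 (1975) (Gaussian inequality); M. Aizenman, H. Duminil-Copin,
Ann. Math. 194 (2021), arXiv:1912.07973 §6.3 (lower inequality and its smeared form); S. Friedli,
Y. Velenik (CUP 2017), Thm. 3.17, Thm. 3.20, Thm. 6.26 (plus state as a Gibbs measure, GKS).
No definitions are introduced.
-/

noncomputable section

namespace Summit.CriticalPhenomena.Ising3DConformalLimit.Cruxes.ExistsScaleCovariantLimit.MonotoneBlockingPort

open Literature.Probability.LatticeModels Filter Set Finset MeasureTheory
open scoped Topology BigOperators
open Summit.CriticalPhenomena.Ising3DConformalLimit.MoebiusLimitExistsOnlyInteraction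
  (criticalCorr_le_pairingSum)
open Summit.CriticalPhenomena.Ising3DConformalLimit.Theorems.GapForcesFarMerging.Negative
  (criticalCorr_nonneg' criticalCorr_translate)

/-! ### Elementary inputs -/

/-- `V(L) = Σ_{x,y ∈ cube L} ⟨σ_xσ_y⟩_{β_c} > 0` for `L ≥ 1`: the term `x = y = 0` is `⟨σ₀σ₀⟩ = 1`
and all terms are `≥ 0` (Griffiths). [folklore] -/
private theorem blockCov_zero_pos {L : ℕ} (hL : 1 ≤ L) : 0 < blockCov L 0 := by
  rw [blockCov_zero_eq]
  have h0 : (0 : Site 3) ∈ cube L := mem_cube.2 fun i => ⟨le_rfl, by simp; omega⟩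
  calc (0 : ℝ) < criticalTwoPoint 3 ((0 : Site 3) - 0) := by
        rw [sub_zero, criticalTwoPoint_zero']
        exact one_pos
    _ ≤ ∑ y ∈ cube L, criticalTwoPoint 3 (y - 0) :=
        Finset.single_le_sum (f := fun y => criticalTwoPoint 3 (y - 0))
          (fun y _ => criticalTwoPoint_nonneg' _) h0
    _ ≤ ∑ x ∈ cube L, ∑ y ∈ cube L, criticalTwoPoint 3 (y - x) :=
        Finset.single_le_sum (f := fun x => ∑ y ∈ cube L, criticalTwoPoint 3 (y - x))
          (fun x _ => Finset.sum_nonneg fun y _ => criticalTwoPoint_nonneg' _) h0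

/-- AM–GM for a product of `n ≥ 1` reals: `∏ᵢ aᵢ ≤ (Σᵢ |aᵢ|ⁿ)/n`. [folklore] -/
private theorem prod_le_sum_abs_pow_div {n : ℕ} (hn : n ≠ 0) (a : Fin n → ℝ) :
    ∏ i, a i ≤ (∑ i, |a i| ^ n) / n := by
  have hw : ∀ i ∈ (Finset.univ : Finset (Fin n)), (0 : ℝ) ≤ (n : ℝ)⁻¹ := fun _ _ => by positivity
  have hw' : ∑ _i : Fin n, (n : ℝ)⁻¹ = 1 := by
    rw [Finset.sum_const, Finset.card_univ, Fintype.card_fin, nsmul_eq_mul, mul_inv_cancel₀]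
    exact_mod_cast hn
  have h := Real.geom_mean_le_arith_mean_weighted Finset.univ (fun _ => (n : ℝ)⁻¹)
    (fun i => |a i| ^ n) hw hw' (fun i _ => by positivity)
  simp only [Real.pow_rpow_inv_natCast (abs_nonneg _) hn] at h
  calc ∏ i, a i ≤ |∏ i, a i| := le_abs_self _
    _ = ∏ i, |a i| := Finset.abs_prod _ _
    _ ≤ ∑ i, (n : ℝ)⁻¹ * |a i| ^ n := h
    _ = (∑ i, |a i| ^ n) / n := by rw [← Finset.mul_sum, div_eq_inv_mul]

/-! ### The smeared Gaussian bound -/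

/-- **Smeared Newman bound for one block**: `Σ_{x⃗ ∈ (cube L)^{2m}} ⟨∏ⱼ σ_{xⱼ + v}⟩_{β_c} ≤
(2m)!/(2ᵐ m!) · V(L)ᵐ` — translation invariance, Newman's Gaussian inequality
`⟨∏σ⟩ ≤ 𝒢_m[⟨σσ⟩]` termwise, and the smeared Wick law with unit weights.
[cite: AizenmanDuminilCopinAnnals2021, arXiv:1912.07973 §6.3, first display, lower inequality (p. 26)] -/
private theorem sum_criticalCorr_shift_le (m L : ℕ) (v : Site 3) :
    ∑ x ∈ Fintype.piFinset (fun _ : Fin (2 * m) => cube L),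
        criticalCorr 3 (2 * m) (fun j => x j + v) ≤
      ((2 * m).factorial : ℝ) / (2 ^ m * m.factorial) * blockCov L 0 ^ m := by
  have hW := sum_prod_mul_pairingSum (cube L) (fun _ => (1 : ℝ))
    (fun a b => criticalCorr 3 2 ![a, b]) m
  simp only [Finset.prod_const_one, one_mul] at hW
  have hV : ∑ a ∈ cube L, ∑ b ∈ cube L, criticalCorr 3 2 ![a, b] = blockCov L 0 := by
    rw [blockCov_zero_eq]
    simp_rw [criticalCorr_two_pair]
  rw [hV] at hW
  rw [← hW]
  refine Finset.sum_le_sum fun x _ => ?_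
  rw [criticalCorr_translate]
  exact criticalCorr_le_pairingSum m x

/-- **The numerator bound**: for `m ≥ 1`, `Σ_{x⃗ ∈ (cube L)^{2m}} ⟨∏ᵢ σ_{xᵢ + L kᵢ}⟩_{β_c} ≤
(2m)!/(2ᵐ m!) · V(L)ᵐ`. The left side is `E[∏ᵢ B(kᵢ)]`, `B(k) = Σ_{x ∈ cube L} σ_{x+Lk}`, for a
plus Gibbs measure at `β_c`; pointwise AM–GM `∏ᵢ B(kᵢ) ≤ (1/2m) Σᵢ B(kᵢ)^{2m}` and the smeared
Newman bound for each `E[B(kᵢ)^{2m}]`.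
[cite: AizenmanDuminilCopinAnnals2021, arXiv:1912.07973 §6.3, first display, lower inequality (p. 26)] -/
private theorem sum_criticalCorr_blocks_le {m : ℕ} (hm : m ≠ 0) (L : ℕ)
    (k : Fin (2 * m) → Site 3) :
    ∑ x ∈ Fintype.piFinset (fun _ : Fin (2 * m) => cube L),
        criticalCorr 3 (2 * m) (fun i => x i + (L : ℤ) • k i) ≤
      ((2 * m).factorial : ℝ) / (2 ^ m * m.factorial) * blockCov L 0 ^ m := by
  classical
  obtain ⟨μ, hμP, hμ⟩ :=
    exists_isProbabilityMeasure_spinCorr_eq_plusCorr 3 (criticalBeta_nonneg 3)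
  -- adapted from `plusExpect_blockSpin_sq_eq_sum` (Literature/…/CriticalBlockMoments.lean)
  have hint : ∀ (n : ℕ) (y : Fin n → Site 3), Integrable (spinMonomial y) μ := fun n y =>
    Integrable.of_bound (measurable_spinMonomial y).aestronglyMeasurable 1
      (Eventually.of_forall fun s => by
        rw [Real.norm_eq_abs]
        simp [spinMonomial, Finset.abs_prod])
  have h2m : 2 * m ≠ 0 := by omega
  set c : ℝ := ((2 * m).factorial : ℝ) / (2 ^ m * m.factorial) * blockCov L 0 ^ m with hc
  -- the block variables, as an opaque function
  obtain ⟨B, hB⟩ : ∃ B : Fin (2 * m) → SpinConfig (Site 3) → ℝ,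
      ∀ i σ, B i σ = ∑ x ∈ cube L, spinAt (x + (L : ℤ) • k i) σ := ⟨_, fun _ _ => rfl⟩
  -- the product of the block variables is the smeared spin monomial
  have hprod : ∀ σ, ∏ i, B i σ = ∑ x ∈ Fintype.piFinset (fun _ : Fin (2 * m) => cube L),
      spinMonomial (fun i => x i + (L : ℤ) • k i) σ := by
    intro σ
    simp only [hB, spinMonomial]
    exact (Finset.sum_prod_piFinset (cube L) fun i y => spinAt (y + (L : ℤ) • k i) σ).symm
  -- even powers of one block variable are smeared spin monomials of one shifted block
  have hpow : ∀ i σ, B i σ ^ (2 * m) = ∑ x ∈ Fintype.piFinset (fun _ : Fin (2 * m) => cube L),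
      spinMonomial (fun j => x j + (L : ℤ) • k i) σ := by
    intro i σ
    simp only [hB, spinMonomial]
    exact Finset.sum_pow' _ _ _
  have hprod_int : Integrable (fun σ => ∏ i, B i σ) μ := by
    simp_rw [hprod]
    exact integrable_finsetSum _ fun x _ => hint _ _
  have hpow_int : ∀ i, Integrable (fun σ => B i σ ^ (2 * m)) μ := by
    intro i
    simp_rw [hpow]
    exact integrable_finsetSum _ fun x _ => hint _ _
  -- Step 1: the numerator is `E[∏ B i]`
  have h1 : ∑ x ∈ Fintype.piFinset (fun _ : Fin (2 * m) => cube L),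
      criticalCorr 3 (2 * m) (fun i => x i + (L : ℤ) • k i) = ∫ σ, ∏ i, B i σ ∂μ := by
    simp_rw [hprod]
    rw [integral_finsetSum _ fun x _ => hint _ _]
    exact Finset.sum_congr rfl fun x _ => criticalCorr_eq_integral_spinMonomial hμ _
  -- Step 2: pointwise AM–GM
  have h2 : ∀ σ, ∏ i, B i σ ≤ (∑ i, B i σ ^ (2 * m)) / (2 * m : ℕ) := by
    intro σ
    have h := prod_le_sum_abs_pow_div h2m (fun i => B i σ)
    simpa only [Even.pow_abs ⟨m, two_mul m⟩] using h
  -- Step 3: each `E[B i ^ (2m)]` is at most `c`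
  have h3 : ∀ i, ∫ σ, B i σ ^ (2 * m) ∂μ ≤ c := by
    intro i
    simp_rw [hpow]
    rw [integral_finsetSum _ fun x _ => hint _ _]
    calc ∑ x ∈ Fintype.piFinset (fun _ : Fin (2 * m) => cube L),
          ∫ σ, spinMonomial (fun j => x j + (L : ℤ) • k i) σ ∂μ
        = ∑ x ∈ Fintype.piFinset (fun _ : Fin (2 * m) => cube L),
            criticalCorr 3 (2 * m) (fun j => x j + (L : ℤ) • k i) :=
          Finset.sum_congr rfl fun x _ => (criticalCorr_eq_integral_spinMonomial hμ _).symm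
      _ ≤ c := sum_criticalCorr_shift_le m L _
  -- assemble
  rw [h1]
  have hpos : (0 : ℝ) < (2 * m : ℕ) := by exact_mod_cast Nat.pos_of_ne_zero h2m
  calc ∫ σ, ∏ i, B i σ ∂μ ≤ ∫ σ, (∑ i, B i σ ^ (2 * m)) / (2 * m : ℕ) ∂μ :=
        integral_mono hprod_int ((integrable_finsetSum _ fun i _ => hpow_int i).div_const _) h2
    _ = (∑ i, ∫ σ, B i σ ^ (2 * m) ∂μ) / (2 * m : ℕ) := by
        rw [integral_div, integral_finsetSum _ fun i _ => hpow_int i]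
    _ ≤ (∑ _i : Fin (2 * m), c) / (2 * m : ℕ) :=
        div_le_div_of_nonneg_right (Finset.sum_le_sum fun i _ => h3 i) hpos.le
    _ = c := by
        rw [Finset.sum_const, Finset.card_univ, Fintype.card_fin, nsmul_eq_mul]
        field_simp

/-! ### The stub -/

/-- **S3 — uniform bounds for the normalised block moments.** For every `n` and every offset vector
`k⃗ ∈ (ℤ³)ⁿ` (coincidences allowed) there is `C` with `|R_n(L; k⃗)| ≤ C` for all `L ≥ 1`: odd `n`
vanish (`criticalCorr_eq_zero_of_odd`); `n = 0` is `|⟨1⟩| ≤ 1`; for `n = 2m ≥ 2` the numerator is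
`≥ 0` (Griffiths I, `criticalCorr_nonneg'`) and at most `(2m)!/(2ᵐ m!) V(L)ᵐ` (plus Gibbs measure,
AM–GM on the block variables, translation invariance, Newman's Gaussian inequality
`criticalCorr_le_pairingSum` and the smeared Wick law `sum_prod_mul_pairingSum`), while the
denominator is `V(L)^{(2m)/2} = V(L)ᵐ > 0`.
[cite: AizenmanDuminilCopinAnnals2021, arXiv:1912.07973 §6.3, first display, lower inequality (p. 26)] -/
theorem stub_blockMomentBounded : Sig.stub_blockMomentBounded := by
  intro n k
  rcases Nat.even_or_odd n with hn | hn
  swap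
  · -- odd orders vanish identically
    refine ⟨0, fun L _ => ?_⟩
    unfold critBlockMoment
    rw [Finset.sum_eq_zero fun x _ => criticalCorr_eq_zero_of_odd (d := 3) le_rfl hn _, zero_div,
      abs_zero]
  rcases Nat.eq_zero_or_pos n with rfl | hpos
  · -- the empty moment
    refine ⟨1, fun L _ => ?_⟩
    unfold critBlockMoment
    rw [Nat.cast_zero, zero_div, Real.rpow_zero, div_one]
    calc |∑ x ∈ Fintype.piFinset (fun _ : Fin 0 => cube L),
          criticalCorr 3 0 (fun i => x i + (L : ℤ) • k i)|
        ≤ ∑ x ∈ Fintype.piFinset (fun _ : Fin 0 => cube L),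
          |criticalCorr 3 0 (fun i => x i + (L : ℤ) • k i)| := Finset.abs_sum_le_sum_abs _ _
      _ ≤ ∑ _x ∈ Fintype.piFinset (fun _ : Fin 0 => cube L), (1 : ℝ) :=
          Finset.sum_le_sum fun x _ => abs_criticalCorr_le_one le_rfl _ _
      _ = 1 := by simp
  obtain ⟨m, hm⟩ := hn
  rw [← two_mul] at hm
  subst hm
  have hm0 : m ≠ 0 := by omega
  refine ⟨((2 * m).factorial : ℝ) / (2 ^ m * m.factorial), fun L hL => ?_⟩
  have hV : 0 < blockCov L 0 := blockCov_zero_pos hL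
  have hN0 : 0 ≤ ∑ x ∈ Fintype.piFinset (fun _ : Fin (2 * m) => cube L),
      criticalCorr 3 (2 * m) (fun i => x i + (L : ℤ) • k i) :=
    Finset.sum_nonneg fun x _ => criticalCorr_nonneg' _
  have hexp : blockCov L 0 ^ (((2 * m : ℕ) : ℝ) / 2) = blockCov L 0 ^ m := by
    rw [show ((2 * m : ℕ) : ℝ) / 2 = ((m : ℕ) : ℝ) by push_cast; ring, Real.rpow_natCast]
  unfold critBlockMoment
  rw [hexp, abs_of_nonneg (div_nonneg hN0 (pow_nonneg hV.le _)), div_le_iff₀ (pow_pos hV _)]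
  exact sum_criticalCorr_blocks_le hm0 L k

end Summit.CriticalPhenomena.Ising3DConformalLimit.Cruxes.ExistsScaleCovariantLimit.MonotoneBlockingPort

end
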